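import Mathlib
import HarnessLib
import Summits.Ventures.LatticeQCDFlow.Exactness.U1UniformJitterHMC
import Summits.Ventures.LatticeQCDFlow.Exactness.U1JitteredHMCFiguresOfMerit
import Summits.Ventures.LatticeQCDFlow.Exactness.UniformJitterLawDensity

/-!
# The `u1_2d` engine's HMC with the transplanted `tau_jitter` law (the code's uniform law of the step): certified burn-in, the CLT, consistent batch-means error bars, asymptotically exact coverage and a consistent `τ̂_int` from EVERY start, whenever `τ(1 − j) < τ₀(d, c)`

HONEST FRAMING: exact (Metropolis-corrected) sampling algorithms for lattice gauge theory;
figures of merit are autocorrelation/cost numbers at stated couplings and volumes; no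
continuum-physics claim.

Venture `LatticeQCDFlow` (cell pub-lqcd), topic `Exactness`, FANOUT row 9 (eng-latcore, GEN-25).  ENGINE READING (honest): in latflow.core 0.2.6 the `tau_jitter` option exists ONLY in `hmc.HMC.trajectory` (4D SU(N) `GaugeField`, 0.2.1+) and `phi4_2d.hmc`; `u1_2d.U1Field2D.hmc_trajectory(beta, rng, tau, nstep)` has NO such option, so the kernel
`u1UniformJitterHMC` of `U1UniformJitterHMC.lean` is the u1_2d HMC kernel WITH THE `hmc.py` RECIPE `tau_t = tau·(1 + tau_jitter·(2u − 1))`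
TRANSPLANTED (what `hmc_trajectory` would run if given the option — a one-line change; NOT an engine path today).  NEW WORK of the cell: the corollaries of
GEN-25's `U1JitteredHMCFiguresOfMerit.lean` (any law of the step charging a short window) for the engine with the transplanted law,
`u1UniformJitterHMC (d := d) (L := L) ρ β c κ n τ j` of `U1UniformJitterHMC.lean` (the label law `uniformJitterLaw (τ/n) j` of the step,
the increment family `(cε)·Z`; `u1Engine_window`: below the threshold `u1EngineTrajThreshold d c` the step law charges a
window on which ONE Lipschitz constant with `4Kε₂n² ≤ 3` and ONE bound serve).  Nothing is cited as a fact; no number is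
claimed.

## Content

**`u1UniformJitterHMC_zero_jitter`** — `tau_jitter = 0` gives back the tree's fixed-step kernel `u1LeapfrogHMCN (τ/n) …`;
**`u1UniformJitterHMC_apply`** — THE TRANSITION PROBABILITY IS THE WINDOW AVERAGE OF THE FIXED-STEP ONES:
`K(U, A) = (2(τ/n)j)⁻¹ ∫_{[(τ/n)(1−j), (τ/n)(1+j)]} K_{n,ε}(U, A) dε` (`τ, j > 0`; `UniformJitterLawDensity`);
`wilson_u1UniformJitterHMC_certificate_nHit`; **`wilson_u1UniformJitterHMC_timeAverage_bias_le`** (burn-in `B/N'` from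
EVERY start); **`wilson_u1UniformJitterHMC_timeAverage_clt`** (CLT for time averages of bounded observables from EVERY
initial law); **`wilson_u1UniformJitterHMC_batchMeans_tendstoInMeasure`** (batch means consistent for `σ²_f`);
**`wilson_u1UniformJitterHMC_batchMeans_coverage`** (asymptotically exact studentized coverage);
**`wilson_u1UniformJitterHMC_tauInt_tendstoInMeasure`** (the reported `τ̂_int` is consistent) — each for every `κ > 0`,
`n ≥ 1`, `τ > 0`, `0 < j ≤ 1` with `τ(1 − j) < τ₀(d, c)` (so for `j = 1` at EVERY `τ`).

NOT CLAIMED: anything for `τ(1 − j) ≥ τ₀`; any value of the constants; that jitter improves any autocorrelation;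
floating point.
-/

noncomputable section

namespace Summit.Ventures.LatticeQCDFlow.Exactness

open MeasureTheory ProbabilityTheory Set Function Filter Topology
open Literature.MathematicalPhysics.QuantumFieldTheory
open Summit.Ventures.LatticeQCDFlow.Scoring (replicaSEsq tauInt autocov kop)
open scoped ENNReal NNReal

set_option backward.isDefEq.respectTransparency false

section AsRun

variable {d L N : ℕ} (ρ : Circle →* Matrix (Fin N) (Fin N) ℂ)

/-- **THE ENGINE'S TRANSITION PROBABILITY UNDER `tau_jitter` IS THE WINDOW AVERAGE OF THE FIXED-STEP TRANSITION
PROBABILITIES** (`τ, j > 0`, `κ > 0`, continuous `ρ`): for every configuration `U` and event `A`,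
`K(U, A) = (2(τ/n)j)⁻¹ ∫_{[(τ/n)(1−j), (τ/n)(1+j)]} K_{n,ε}(U, A) dε` with `K_{n,ε}` the tree's fixed-step kernel
`u1LeapfrogHMCN ε κ _ (β S_W) n` driven by the increment `(cε)·Z`. -/
theorem u1UniformJitterHMC_apply [NeZero L] (hρ : Continuous ρ) (β c : ℝ) {κ : ℝ} (hκ : 0 < κ) {n : ℕ} (hn : 1 ≤ n)
    {τ j : ℝ} (hτ : 0 < τ) (hj : 0 < j) (U : GaugeConfig d L Circle) {A : Set (GaugeConfig d L Circle)}
    (hA : MeasurableSet A) :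
    u1UniformJitterHMC (d := d) (L := L) ρ β c κ n τ j U A =
      (ENNReal.ofReal (2 * (τ / n) * j))⁻¹ *
        ∫⁻ ε in Icc (τ / n * (1 - j)) (τ / n * (1 + j)),
          u1LeapfrogHMCN ε κ (measurable_slice_of_uncurry (measurable_uncurry_u1EngineIncrement (d := d) (L := L) c) ε)
            (fun U : GaugeConfig d L Circle => β * wilsonAction ρ U) n U A := by
  haveI : Fact (0 < κ) := ⟨hκ⟩
  have hn' : (0 : ℝ) < n := by exact_mod_cast hn
  rw [u1UniformJitterHMC, u1JitterHMCL_apply (continuous_smul_wilsonAction ρ hρ β).measurable U hA,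
    uniformJitterLaw_eq_smul_restrict_Icc (div_pos hτ hn') hj, lintegral_smul_measure, smul_eq_mul]
  rfl

/-- **`tau_jitter = 0` IS THE DEFAULT FIXED-STEP PATH**: at `j = 0` the law of the step is the point mass at `τ/n` and
the engine kernel with the transplanted law is the tree's fixed-step `n`-step leapfrog kernel `u1LeapfrogHMCN (τ/n) κ _ (β S_W) n` with the
increment `(c τ/n)·Z` (`κ > 0`, continuous `ρ`). -/
theorem u1UniformJitterHMC_zero_jitter [NeZero L] (hρ : Continuous ρ) (β c : ℝ) {κ : ℝ} (hκ : 0 < κ) (n : ℕ) (τ : ℝ) :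
    u1UniformJitterHMC (d := d) (L := L) ρ β c κ n τ 0 =
      u1LeapfrogHMCN (τ / n) κ
        (measurable_slice_of_uncurry (measurable_uncurry_u1EngineIncrement (d := d) (L := L) c) (τ / n))
        (fun U : GaugeConfig d L Circle => β * wilsonAction ρ U) n := by
  haveI : Fact (0 < κ) := ⟨hκ⟩
  refine Kernel.ext fun U => Measure.ext fun A hA => ?_
  rw [u1UniformJitterHMC, u1JitterHMCL_apply (continuous_smul_wilsonAction ρ hρ β).measurable U hA,
    uniformJitterLaw_zero_right, lintegral_dirac]
  rfl

/-- **THE ONE-HIT DOEBLIN CERTIFICATE OF THE JITTERED u1_2d KERNEL** whenever `τ(1 − j) < τ₀(d, c)`. -/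
theorem wilson_u1UniformJitterHMC_certificate_nHit [NeZero L] (hρ : Continuous ρ) (β c : ℝ) {κ : ℝ} (hκ : 0 < κ)
    {n : ℕ} (hn : 1 ≤ n) {τ j : ℝ} (hτ : 0 < τ) (hj : 0 < j) (hj1 : j ≤ 1)
    (hshort : τ * (1 - j) < u1EngineTrajThreshold d c) :
    Kernel.Invariant (u1UniformJitterHMC (d := d) (L := L) ρ β c κ n τ j) (wilsonMeasure (d := d) (L := L) ρ β) ∧
      ∃ ε' : ℝ≥0∞, 0 < ε' ∧ ε' ≤ 1 ∧ ∀ U : GaugeConfig d L Circle,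
        ε' • Measure.pi (fun _ : Edge d L => haarProbability Circle) ≤ nHit (u1UniformJitterHMC (d := d) (L := L) ρ β c κ n τ j) 1 U := by
  obtain ⟨ε₁, ε₂, hε₁, h12, hK, hshort', hb, hη⟩ := u1Engine_window (d := d) (L := L) c hn hτ hj hj1 hshort
  exact wilson_u1JitterHMCL_certificate_nHit ρ hρ β hε₁ h12 hκ hn (measurable_uncurry_u1EngineIncrement c) hK hshort'
    (by have := (u1EngineTrajThreshold_pos d c).le; positivity) hb (uniformJitterLaw (τ / n) j) hη

/-! ## Figures of merit of the engine with the transplanted law -/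

/-- **CERTIFIED BURN-IN OF THE `u1_2d` JITTERED HMC (transplanted `tau_jitter` law) FROM EVERY START**: one `B ≥ 0` with
`|E_{μ₀}[(1/N') Σ_{t<N'} q(U_t)] − ∫ q dπ| ≤ B/N'` for EVERY initial law, every `[0,1]`-valued measurable `q`, `N' ≥ 1`. -/
theorem wilson_u1UniformJitterHMC_timeAverage_bias_le [NeZero L] (hρ : Continuous ρ) (β c : ℝ) {κ : ℝ} (hκ : 0 < κ) {n : ℕ} (hn : 1 ≤ n)
    {τ j : ℝ} (hτ : 0 < τ) (hj : 0 < j) (hj1 : j ≤ 1) (hshort : τ * (1 - j) < u1EngineTrajThreshold d c)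
    [IsMarkovKernel (u1UniformJitterHMC (d := d) (L := L) ρ β c κ n τ j)] :
    ∃ B : ℝ, 0 ≤ B ∧ ∀ (μ₀ : Measure (GaugeConfig d L Circle)) [IsProbabilityMeasure μ₀]
      (q : GaugeConfig d L Circle → ℝ), Measurable q → (∀ U, 0 ≤ q U) → (∀ U, q U ≤ 1) →
      ∀ N' : ℕ, N' ≠ 0 →
      |∫ x, (∑ t ∈ Finset.range N', q (x t)) / N'
          ∂(Kernel.trajMeasure (X := fun _ : ℕ => GaugeConfig d L Circle) μ₀
              (fun t : ℕ => (u1UniformJitterHMC (d := d) (L := L) ρ β c κ n τ j).comap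
                (fun h : (i : ↥(Finset.Iic t)) → GaugeConfig d L Circle =>
                  h ⟨t, Finset.mem_Iic.2 le_rfl⟩) (measurable_pi_apply _)))
        - ∫ U, q U ∂(wilsonMeasure (d := d) (L := L) ρ β)| ≤ B / N' := by
  haveI := isProbabilityMeasure_wilsonMeasure (d := d) (L := L) ρ hρ β
  obtain ⟨hinv, ε', hε0, hε1, hmin⟩ := wilson_u1UniformJitterHMC_certificate_nHit (d := d) (L := L) ρ hρ β c hκ hn hτ hj hj1 hshort
  have he0 : 0 < ε'.toReal := ENNReal.toReal_pos hε0.ne' (ne_top_of_le_ne_top ENNReal.one_ne_top hε1)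
  refine ⟨1 / ε'.toReal, by positivity, fun μ₀ _ q hq h0 h1 N' hN => ?_⟩
  calc _ ≤ ((1 : ℕ) : ℝ) / (ε'.toReal * N') :=
        GeneralNCMC.chain_timeAverage_bias_le_of_nHit (GeneralNCMC.minorised_setwise hmin) hε0 hε1 Nat.one_pos
          hinv μ₀ hq h0 h1 hN
    _ = 1 / ε'.toReal / N' := by rw [Nat.cast_one, div_div]

/-- **THE CLT FOR TIME AVERAGES OF THE `u1_2d` JITTERED HMC (transplanted `tau_jitter` law), FROM EVERY INITIAL LAW** (`|f| ≤ C` measurable,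
`Y ~ N(0, σ²_f)`): `(√N')⁻¹ Σ_{t<N'} (f(U_t) − π f) ⇒ Y` under `P_{μ₀}`. -/
theorem wilson_u1UniformJitterHMC_timeAverage_clt [NeZero L] (hρ : Continuous ρ) (β c : ℝ) {κ : ℝ} (hκ : 0 < κ) {n : ℕ} (hn : 1 ≤ n)
    {τ j : ℝ} (hτ : 0 < τ) (hj : 0 < j) (hj1 : j ≤ 1) (hshort : τ * (1 - j) < u1EngineTrajThreshold d c)
    [IsMarkovKernel (u1UniformJitterHMC (d := d) (L := L) ρ β c κ n τ j)]
    {f : GaugeConfig d L Circle → ℝ} (hf : Measurable f) {C : ℝ} (hC : ∀ U, |f U| ≤ C)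
    (μ₀ : Measure (GaugeConfig d L Circle)) [IsProbabilityMeasure μ₀]
    [IsProbabilityMeasure (Kernel.trajMeasure (X := fun _ : ℕ => GaugeConfig d L Circle) μ₀
              (fun t : ℕ => (u1UniformJitterHMC (d := d) (L := L) ρ β c κ n τ j).comap
                (fun h : (i : ↥(Finset.Iic t)) → GaugeConfig d L Circle =>
                  h ⟨t, Finset.mem_Iic.2 le_rfl⟩) (measurable_pi_apply _)))]
    {Ω' : Type*} [MeasurableSpace Ω'] {P' : Measure Ω'} [IsProbabilityMeasure P'] {Y : Ω' → ℝ}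
    (hY : HasLaw Y (gaussianReal 0 (Real.toNNReal
      ((∫ y, (f y - ∫ z, f z ∂(wilsonMeasure (d := d) (L := L) ρ β)) ^ 2 ∂(wilsonMeasure (d := d) (L := L) ρ β))
              + 2 * ∑' k, ∫ y, (f y - ∫ z, f z ∂(wilsonMeasure (d := d) (L := L) ρ β))
                * (kop (u1UniformJitterHMC (d := d) (L := L) ρ β c κ n τ j))^[k + 1]
                  (fun y => f y - ∫ z, f z ∂(wilsonMeasure (d := d) (L := L) ρ β)) y ∂(wilsonMeasure (d := d) (L := L) ρ β)))) P') :
    TendstoInDistribution (fun (N' : ℕ) (x : ℕ → GaugeConfig d L Circle) =>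
        (Real.sqrt N')⁻¹ * ∑ t ∈ Finset.range N', (f (x t) - ∫ z, f z ∂(wilsonMeasure (d := d) (L := L) ρ β)))
      atTop Y (fun _ => (Kernel.trajMeasure (X := fun _ : ℕ => GaugeConfig d L Circle) μ₀
              (fun t : ℕ => (u1UniformJitterHMC (d := d) (L := L) ρ β c κ n τ j).comap
                (fun h : (i : ↥(Finset.Iic t)) → GaugeConfig d L Circle =>
                  h ⟨t, Finset.mem_Iic.2 le_rfl⟩) (measurable_pi_apply _)))) P' := by
  haveI := isProbabilityMeasure_wilsonMeasure (d := d) (L := L) ρ hρ β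
  obtain ⟨hinv, ε', hε0, -, hmin⟩ := wilson_u1UniformJitterHMC_certificate_nHit (d := d) (L := L) ρ hρ β c hκ hn hτ hj hj1 hshort
  exact GeneralNCMC.tendstoInDistribution_timeAverage_of_nHit hinv hε0.ne' hmin Nat.one_pos hf hC μ₀ hY

/-- **BATCH MEANS ESTIMATE `σ²_f` CONSISTENTLY ALONG THE `u1_2d` JITTERED HMC (transplanted `tau_jitter` law), FROM EVERY INITIAL LAW.** -/
theorem wilson_u1UniformJitterHMC_batchMeans_tendstoInMeasure [NeZero L] (hρ : Continuous ρ) (β c : ℝ) {κ : ℝ} (hκ : 0 < κ) {n : ℕ} (hn : 1 ≤ n)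
    {τ j : ℝ} (hτ : 0 < τ) (hj : 0 < j) (hj1 : j ≤ 1) (hshort : τ * (1 - j) < u1EngineTrajThreshold d c)
    [IsMarkovKernel (u1UniformJitterHMC (d := d) (L := L) ρ β c κ n τ j)]
    {f : GaugeConfig d L Circle → ℝ} (hf : Measurable f) {C : ℝ} (hC : ∀ U, |f U| ≤ C)
    (μ₀ : Measure (GaugeConfig d L Circle)) [IsProbabilityMeasure μ₀]
    {a b' : ℕ → ℕ} (ha : Tendsto a atTop atTop) (hb' : Tendsto b' atTop atTop) :
    TendstoInMeasure (Kernel.trajMeasure (X := fun _ : ℕ => GaugeConfig d L Circle) μ₀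
              (fun t : ℕ => (u1UniformJitterHMC (d := d) (L := L) ρ β c κ n τ j).comap
                (fun h : (i : ↥(Finset.Iic t)) → GaugeConfig d L Circle =>
                  h ⟨t, Finset.mem_Iic.2 le_rfl⟩) (measurable_pi_apply _)))
      (fun (N' : ℕ) (x : ℕ → GaugeConfig d L Circle) => ((b' N' * a N' : ℕ) : ℝ)
        * replicaSEsq (fun j (x : ℕ → GaugeConfig d L Circle) =>
            (∑ i ∈ Finset.range (b' N'), f (x (b' N' * j + i))) / (b' N')) (a N') x)
      atTop (fun _ => (∫ y, (f y - ∫ z, f z ∂(wilsonMeasure (d := d) (L := L) ρ β)) ^ 2 ∂(wilsonMeasure (d := d) (L := L) ρ β))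
              + 2 * ∑' k, ∫ y, (f y - ∫ z, f z ∂(wilsonMeasure (d := d) (L := L) ρ β))
                * (kop (u1UniformJitterHMC (d := d) (L := L) ρ β c κ n τ j))^[k + 1]
                  (fun y => f y - ∫ z, f z ∂(wilsonMeasure (d := d) (L := L) ρ β)) y ∂(wilsonMeasure (d := d) (L := L) ρ β)) := by
  haveI := isProbabilityMeasure_wilsonMeasure (d := d) (L := L) ρ hρ β
  obtain ⟨hinv, ε', hε0, hε1, hmin⟩ := wilson_u1UniformJitterHMC_certificate_nHit (d := d) (L := L) ρ hρ β c hκ hn hτ hj hj1 hshort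
  exact Scoring.chain_batchMeans_sigmaHat_tendstoInMeasure_of_nHit hinv (GeneralNCMC.minorised_setwise hmin)
    hε0 hε1 Nat.one_pos hf hC μ₀ ha hb'

/-- **THE BATCH-MEANS INTERVAL OF A `u1_2d` `tau_jitter` HMC RUN IS ASYMPTOTICALLY EXACT** (`σ²_f > 0`, any initial law,
`z > 0`): `P_{μ₀}(|√(ab) (f̄_{ab} − π f)| ≤ z σ̂_BM) → (gaussianReal 0 1)[−z, z]`. -/
theorem wilson_u1UniformJitterHMC_batchMeans_coverage [NeZero L] (hρ : Continuous ρ) (β c : ℝ) {κ : ℝ} (hκ : 0 < κ) {n : ℕ} (hn : 1 ≤ n)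
    {τ j : ℝ} (hτ : 0 < τ) (hj : 0 < j) (hj1 : j ≤ 1) (hshort : τ * (1 - j) < u1EngineTrajThreshold d c)
    [IsMarkovKernel (u1UniformJitterHMC (d := d) (L := L) ρ β c κ n τ j)]
    {f : GaugeConfig d L Circle → ℝ} (hf : Measurable f) {C : ℝ} (hC : ∀ U, |f U| ≤ C)
    (hσ : 0 < (∫ y, (f y - ∫ z, f z ∂(wilsonMeasure (d := d) (L := L) ρ β)) ^ 2 ∂(wilsonMeasure (d := d) (L := L) ρ β))
              + 2 * ∑' k, ∫ y, (f y - ∫ z, f z ∂(wilsonMeasure (d := d) (L := L) ρ β))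
                * (kop (u1UniformJitterHMC (d := d) (L := L) ρ β c κ n τ j))^[k + 1]
                  (fun y => f y - ∫ z, f z ∂(wilsonMeasure (d := d) (L := L) ρ β)) y ∂(wilsonMeasure (d := d) (L := L) ρ β))
    (μ₀ : Measure (GaugeConfig d L Circle)) [IsProbabilityMeasure μ₀]
    {a b' : ℕ → ℕ} (ha : Tendsto a atTop atTop) (hb' : Tendsto b' atTop atTop) {z : ℝ} (hz : 0 < z) :
    Tendsto (fun N' : ℕ => (Kernel.trajMeasure (X := fun _ : ℕ => GaugeConfig d L Circle) μ₀
              (fun t : ℕ => (u1UniformJitterHMC (d := d) (L := L) ρ β c κ n τ j).comap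
                (fun h : (i : ↥(Finset.Iic t)) → GaugeConfig d L Circle =>
                  h ⟨t, Finset.mem_Iic.2 le_rfl⟩) (measurable_pi_apply _))).real
      {x | |((Real.sqrt ((b' N' * a N' : ℕ) : ℝ))⁻¹
          * ∑ t ∈ Finset.range (b' N' * a N'), (f (x t) - ∫ z, f z ∂(wilsonMeasure (d := d) (L := L) ρ β)))
        / Real.sqrt (((b' N' * a N' : ℕ) : ℝ)
          * replicaSEsq (fun j (x : ℕ → GaugeConfig d L Circle) =>
              (∑ i ∈ Finset.range (b' N'), f (x (b' N' * j + i))) / (b' N')) (a N') x)| ≤ z})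
      atTop (𝓝 ((gaussianReal 0 1).real (Set.Icc (-z) z))) := by
  haveI := isProbabilityMeasure_wilsonMeasure (d := d) (L := L) ρ hρ β
  obtain ⟨hinv, ε', hε0, hε1, hmin⟩ := wilson_u1UniformJitterHMC_certificate_nHit (d := d) (L := L) ρ hρ β c hκ hn hτ hj hj1 hshort
  exact Scoring.doeblinPower_batchMeans_studentized_coverage hinv hmin hε0 hε1 Nat.one_pos hf hC hσ μ₀ ha hb' hz

/-- **THE REPORTED `τ̂_int = σ̂²_BM/(2 v̂)` OF A `u1_2d` `tau_jitter` HMC RUN IS CONSISTENT** (`Var_π f ≠ 0`, any initial law). -/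
theorem wilson_u1UniformJitterHMC_tauInt_tendstoInMeasure [NeZero L] (hρ : Continuous ρ) (β c : ℝ) {κ : ℝ} (hκ : 0 < κ) {n : ℕ} (hn : 1 ≤ n)
    {τ j : ℝ} (hτ : 0 < τ) (hj : 0 < j) (hj1 : j ≤ 1) (hshort : τ * (1 - j) < u1EngineTrajThreshold d c)
    [IsMarkovKernel (u1UniformJitterHMC (d := d) (L := L) ρ β c κ n τ j)]
    {f : GaugeConfig d L Circle → ℝ} (hf : Measurable f) {C : ℝ} (hC : ∀ U, |f U| ≤ C)
    (hvar : autocov (u1UniformJitterHMC (d := d) (L := L) ρ β c κ n τ j)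
        (wilsonMeasure (d := d) (L := L) ρ β) (fun y => f y - ∫ z, f z ∂(wilsonMeasure (d := d) (L := L) ρ β)) 0 ≠ 0)
    (μ₀ : Measure (GaugeConfig d L Circle)) [IsProbabilityMeasure μ₀]
    {a b' : ℕ → ℕ} (ha : Tendsto a atTop atTop) (hb' : Tendsto b' atTop atTop) :
    TendstoInMeasure (Kernel.trajMeasure (X := fun _ : ℕ => GaugeConfig d L Circle) μ₀
              (fun t : ℕ => (u1UniformJitterHMC (d := d) (L := L) ρ β c κ n τ j).comap
                (fun h : (i : ↥(Finset.Iic t)) → GaugeConfig d L Circle =>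
                  h ⟨t, Finset.mem_Iic.2 le_rfl⟩) (measurable_pi_apply _)))
      (fun (N' : ℕ) (x : ℕ → GaugeConfig d L Circle) =>
        (((b' N' * a N' : ℕ) : ℝ)
          * replicaSEsq (fun j (x : ℕ → GaugeConfig d L Circle) =>
              (∑ i ∈ Finset.range (b' N'), f (x (b' N' * j + i))) / (b' N')) (a N') x)
        / (2 * ((∑ t ∈ Finset.range (b' N' * a N'), f (x t) ^ 2) / ((b' N' * a N' : ℕ) : ℝ)
            - ((∑ t ∈ Finset.range (b' N' * a N'), f (x t)) / ((b' N' * a N' : ℕ) : ℝ)) ^ 2)))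
      atTop (fun _ => tauInt (fun t =>
        autocov (u1UniformJitterHMC (d := d) (L := L) ρ β c κ n τ j)
            (wilsonMeasure (d := d) (L := L) ρ β) (fun y => f y - ∫ z, f z ∂(wilsonMeasure (d := d) (L := L) ρ β)) t
          / autocov (u1UniformJitterHMC (d := d) (L := L) ρ β c κ n τ j)
            (wilsonMeasure (d := d) (L := L) ρ β) (fun y => f y - ∫ z, f z ∂(wilsonMeasure (d := d) (L := L) ρ β)) 0)) := by
  haveI := isProbabilityMeasure_wilsonMeasure (d := d) (L := L) ρ hρ β
  obtain ⟨hinv, ε', hε0, hε1, hmin⟩ := wilson_u1UniformJitterHMC_certificate_nHit (d := d) (L := L) ρ hρ β c hκ hn hτ hj hj1 hshort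
  exact Scoring.chain_batchMeans_tauInt_tendstoInMeasure_of_nHit hinv hmin hε0 hε1 Nat.one_pos hf hC hvar μ₀ ha hb'

end AsRun

end Summit.Ventures.LatticeQCDFlow.Exactness
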